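import Literature.NumberTheory.LFunctions.ConreyIwaniec2002RootNumberQuotientUpper
import Literature.NumberTheory.LFunctions.ConreyIwaniec2002AFEDefs
import Literature.NumberTheory.LFunctions.ConreyIwaniec2002AFE
import Literature.NumberTheory.QuadraticFields.QuadraticDifferentPrincipal
import Literature.NumberTheory.LFunctions.ClassGroupXi
import Mathlib.NumberTheory.NumberField.DedekindZeta
import HarnessLib

/-!
# Conrey–Iwaniec (2002), Proposition 8.1 (`_large_close` form) from the three mean squares of §8

B. Conrey, H. Iwaniec, *Spacing of zeros of Hecke L-functions and the class number problem*,
Acta Arith. 103 (2002), §7 (7.12)–(7.23), §8 (8.4)–(8.10) [held text `paper:arxiv-math_0111012`,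
p0017–p0018].

This is the kernel COMPOSITION of the line `prop81-afe-plancherel` for the named statement
`conreyIwaniec2002_proposition81_large_close` (`ConreyIwaniec2002AFEDefs`): from
* Proposition 7.1 on `Re s = ½` (`classGroupLFunction_eq_afe_all`): `L = A + W·X·conj A + R`,
* `W(ψ) = ψ([𝔡_K]) = 1` (`Quadratic.differentClass_eq_one_of_finrank_eq_two`),
* `|X(½+it)| = 1` (`norm_afeX_half`), `|x(s)| ≤ C₃(log q + log t)` (`norm_xQuot_le`),
* and the THREE MEAN SQUARES of §8 taken as the hypothesis `hS6`:
  (i) `Σ_s |B(s)|² ≪ T(log q)^7 + Tℒ(T)(log T)^4` (`B = (A(s) − A(s′))/(s − s′)`), (ii)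
  `(log T)² Σ_s |A(s) − N(s)|² ≪` the same, (iii) `Σ_s |r(s)|² ≪ T` (residual),
one gets `D(T) = Σ_s |ℓ(s) − x(s)N̄(s)|² ≪ T(log q)^7 + Tℒ(T)(log T)^4` for `1`-spaced `S ⊂ (T,2T]`,
`T ≥ q^66`, `T ≥ e^{(log q)²}`, companions `|t′ − t| ≤ 1` (off the diagonal by the pointwise identity
(7.23) `ℓ − xN̄ = B − X(s′)conj B + x·conj(A − N) + r` and `(a+b+c)² ≤ 3(…)`; coincident companions
by the limit `t′ → t`, `defectD_limit`). The mean squares themselves are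
`ConreyIwaniec2002Prop81MeanSquares.main_meanSquares` (from Proposition 6.4) plus the residual and
divisor-moment inputs of the line; this file is independent of them. Everything PROVED; no definition.

«The programme SEARCHES and TYPES; no claim about Landau–Siegel zeros until a kernel theorem says so.»

## References
* [ConreyIwaniec2002] B. Conrey, H. Iwaniec, Acta Arith. 103 (2002) 259–312, arXiv:math/0111012:
  §7 (7.12)–(7.23); §8 (8.4)–(8.10).
-/

noncomputable section

open scoped NumberField
open Complex MeasureTheory Filter Topology

namespace Literature.NumberTheory.LFunctions

namespace ConreyIwaniec2002

open NumberField Literature.NumberTheory.LFunctions.NumberField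

/-! ## The composition of §§7–8 -/

/-- **The pointwise identity behind (7.23)**: from `L = A + X·conj A + R` at `s` and at `s′ ≠ s`
(both on the critical line, so `conj (s − s′) = −(s − s′)`),
`ℓ(s) − x(s)N̄(s) = B(s) − X(s′)·conj B(s) + x(s)·conj(A(s) − N(s)) + r(s)`.
[cite: ConreyIwaniec2002, §7 (7.23)] -/
theorem pointwise_identity {L A X R : ℂ → ℂ} {t t' : ℝ} (htt' : t' ≠ t) (N : ℂ)
    (hs : L (1 / 2 + t * I) = A (1 / 2 + t * I) + X (1 / 2 + t * I) *
      starRingEnd ℂ (A (1 / 2 + t * I)) + R (1 / 2 + t * I))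
    (hs' : L (1 / 2 + t' * I) = A (1 / 2 + t' * I) + X (1 / 2 + t' * I) *
      starRingEnd ℂ (A (1 / 2 + t' * I)) + R (1 / 2 + t' * I)) :
    dividedDifference L (1 / 2 + t * I) (1 / 2 + t' * I) -
        dividedDifference X (1 / 2 + t * I) (1 / 2 + t' * I) * starRingEnd ℂ N =
      (A (1 / 2 + t * I) - A (1 / 2 + t' * I)) / ((t : ℂ) * I - t' * I) -
        X (1 / 2 + t' * I) *
          starRingEnd ℂ ((A (1 / 2 + t * I) - A (1 / 2 + t' * I)) / ((t : ℂ) * I - t' * I)) +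
        dividedDifference X (1 / 2 + t * I) (1 / 2 + t' * I) *
          starRingEnd ℂ (A (1 / 2 + t * I) - N) +
        (R (1 / 2 + t * I) - R (1 / 2 + t' * I)) / ((t : ℂ) * I - t' * I) := by
  have hne : (1 / 2 + t' * I : ℂ) ≠ 1 / 2 + t * I := by
    intro h
    apply htt'
    have := congrArg Complex.im h
    simpa using this
  have hd : (1 / 2 + t * I : ℂ) - (1 / 2 + t' * I) = (t : ℂ) * I - t' * I := by ring
  have hd0 : ((t : ℂ) * I - t' * I) ≠ 0 := by
    rw [← hd]; exact sub_ne_zero.mpr (Ne.symm hne)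
  have hconj : starRingEnd ℂ ((t : ℂ) * I - t' * I) = -((t : ℂ) * I - t' * I) := by
    simp [map_sub, map_mul, Complex.conj_ofReal, Complex.conj_I]; ring
  rw [dividedDifference_of_ne L hne, dividedDifference_of_ne X hne, hd, hs, hs']
  set d : ℂ := (t : ℂ) * I - t' * I with hd_def
  set a := A (1 / 2 + t * I)
  set a' := A (1 / 2 + t' * I)
  set x := X (1 / 2 + t * I)
  set x' := X (1 / 2 + t' * I)
  set r := R (1 / 2 + t * I)
  set r' := R (1 / 2 + t' * I)
  have h1 : starRingEnd ℂ ((a - a') / d) = -(starRingEnd ℂ (a - a')) / d := by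
    rw [map_div₀, hconj, div_neg, neg_div]
  rw [h1, map_sub, map_sub]
  field_simp
  ring

/-- **The pointwise inequality**: `|ℓ − xN̄|² ≤ 12|B|² + 3|x|²|A − N|² + 3|r|²` once `|X(s′)| = 1`.
[cite: ConreyIwaniec2002, §8 (before Proposition 8.1)] -/
theorem norm_sq_le_three {ℓxN B X' Bc xq AN r : ℂ} (hX' : ‖X'‖ = 1) (hBc : ‖Bc‖ = ‖B‖)
    (h : ℓxN = B - X' * Bc + xq * AN + r) :
    ‖ℓxN‖ ^ 2 ≤ 12 * ‖B‖ ^ 2 + 3 * (‖xq‖ ^ 2 * ‖AN‖ ^ 2) + 3 * ‖r‖ ^ 2 := by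
  have h1 : ‖ℓxN‖ ≤ 2 * ‖B‖ + ‖xq‖ * ‖AN‖ + ‖r‖ := by
    rw [h]
    calc ‖B - X' * Bc + xq * AN + r‖ ≤ ‖B - X' * Bc + xq * AN‖ + ‖r‖ := norm_add_le _ _
      _ ≤ ‖B - X' * Bc‖ + ‖xq * AN‖ + ‖r‖ := by gcongr; exact norm_add_le _ _
      _ ≤ (‖B‖ + ‖X' * Bc‖) + ‖xq‖ * ‖AN‖ + ‖r‖ := by
          gcongr
          · exact norm_sub_le _ _
          · exact (norm_mul_le _ _)
      _ = 2 * ‖B‖ + ‖xq‖ * ‖AN‖ + ‖r‖ := by rw [norm_mul, hX', hBc]; ring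
  have h0 : 0 ≤ 2 * ‖B‖ + ‖xq‖ * ‖AN‖ + ‖r‖ := by positivity
  calc ‖ℓxN‖ ^ 2 ≤ (2 * ‖B‖ + ‖xq‖ * ‖AN‖ + ‖r‖) ^ 2 :=
        pow_le_pow_left₀ (norm_nonneg _) h1 2
    _ ≤ 3 * ((2 * ‖B‖) ^ 2 + (‖xq‖ * ‖AN‖) ^ 2 + ‖r‖ ^ 2) := by
        nlinarith [sq_nonneg (2 * ‖B‖ - ‖xq‖ * ‖AN‖), sq_nonneg (‖xq‖ * ‖AN‖ - ‖r‖),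
          sq_nonneg (2 * ‖B‖ - ‖r‖)]
    _ = 12 * ‖B‖ ^ 2 + 3 * (‖xq‖ ^ 2 * ‖AN‖ ^ 2) + 3 * ‖r‖ ^ 2 := by ring

/-- **Proposition 8.1 (`_large_close`) for companions OFF the diagonal** from the mean squares `hS6`: the
identity, `|X| = 1` on the critical line (tree `norm_afeX_half`), `|x(s)| ≤ C₃(log q + log t)`
(tree `norm_xQuot_le`), and S6. [cite: ConreyIwaniec2002, Proposition 8.1 (8.10)] -/
theorem defectD_le_of_meanSquares (hS6 : ∃ C : ℝ, 0 < C ∧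
    ∀ (q : ℕ) [NeZero q], 4 < q → Odd q → ∀ χ : DirichletCharacter ℂ q,
      χ.IsPrimitive → χ.IsQuadratic → χ.Odd →
        ∀ (K : Type) [Field K] [NumberField K],
          Module.finrank ℚ K = 2 → NumberField.discr K = -(q : ℤ) →
            ∀ (ψ : ClassGroup (𝓞 K) →* ℂˣ) (T : ℝ) (S : Finset ℝ) (t' : ℝ → ℝ),
              (q : ℝ) ^ (66 : ℕ) ≤ T → Real.exp (Real.log q ^ (2 : ℕ)) ≤ T → IsDyadicPointSet S T →
                (∀ t ∈ S, t' t ≠ t ∧ |t' t - t| ≤ 1) →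
                (∑ t ∈ S, ‖(afeA K ψ q (1 / 2 + t * I) - afeA K ψ q (1 / 2 + t' t * I)) /
                    ((t : ℂ) * I - t' t * I)‖ ^ 2 ≤
                  C * (T * Real.log q ^ (7 : ℕ) + T * calL χ T * Real.log T ^ (4 : ℕ))) ∧
                (Real.log T ^ (2 : ℕ) *
                    ∑ t ∈ S, ‖afeA K ψ q (1 / 2 + t * I) - shortLSum K ψ q (1 / 2 + t * I)‖ ^ 2 ≤
                  C * (T * Real.log q ^ (7 : ℕ) + T * calL χ T * Real.log T ^ (4 : ℕ))) ∧
                (∑ t ∈ S, ‖(afeR K ψ q (1 / 2 + t * I) - afeR K ψ q (1 / 2 + t' t * I)) /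
                    ((t : ℂ) * I - t' t * I)‖ ^ 2 ≤ C * T)) :
    ∃ C : ℝ, 0 < C ∧
    ∀ (q : ℕ) [NeZero q], 4 < q → Odd q → ∀ χ : DirichletCharacter ℂ q,
      χ.IsPrimitive → χ.IsQuadratic → χ.Odd →
        ∀ (K : Type) [Field K] [NumberField K],
          Module.finrank ℚ K = 2 → NumberField.discr K = -(q : ℤ) →
            ∀ (ψ : ClassGroup (𝓞 K) →* ℂˣ) (T : ℝ) (S : Finset ℝ) (t' : ℝ → ℝ),
              (q : ℝ) ^ (66 : ℕ) ≤ T → Real.exp (Real.log q ^ (2 : ℕ)) ≤ T → IsDyadicPointSet S T →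
                (∀ t ∈ S, t' t ≠ t ∧ |t' t - t| ≤ 1) →
                defectD K ψ q S t' ≤
                  C * (T * Real.log q ^ (7 : ℕ) + T * calL χ T * Real.log T ^ (4 : ℕ)) := by
  obtain ⟨C₆, hC₆, h6⟩ := hS6
  obtain ⟨C₃, hC₃, hx⟩ := norm_xQuot_le
  refine ⟨15 * C₆ + 27 * C₃ ^ 2 * C₆, by positivity,
    fun q _ hq hodd χ hprim hquad hoddχ K _ _ h2 hdisc ψ T S t' hT hexpT hS hclose => ?_⟩
  classical
  have hq0 : 0 < q := by omega
  have hq5 : (5 : ℝ) ≤ q := by exact_mod_cast hq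
  have hℓ1 : 1 < Real.log q := by
    rw [Real.lt_log_iff_exp_lt (by linarith)]
    exact Real.exp_one_lt_d9.trans_le (by linarith)
  set ℓ : ℝ := Real.log q with hℓdef
  -- `q ≤ q^66 ≤ T`, so `log q ≤ log T`, `2 ≤ T`
  have hq_le_T : (q : ℝ) ≤ T := le_trans (le_self_pow₀ (by linarith) (by norm_num)) hT
  have hT2 : (2 : ℝ) ≤ T := by linarith
  have hT0 : 0 < T := by linarith
  set LT : ℝ := Real.log T with hLTdef
  have hℓLT : ℓ ≤ LT := Real.log_le_log (by positivity) hq_le_T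
  have hLT1 : 1 < LT := lt_of_lt_of_le hℓ1 hℓLT
  have hLT0 : 0 < LT := by linarith
  -- the three mean squares
  obtain ⟨hB, hAN, hr⟩ := h6 q hq hodd χ hprim hquad hoddχ K h2 hdisc ψ T S t' hT hexpT hS hclose
  -- root number `W = 1`
  have hW : (ψ (differentClass K) : ℂ) = 1 := by
    rw [Literature.NumberTheory.QuadraticFields.Quadratic.differentClass_eq_one_of_finrank_eq_two K h2,
      map_one, Units.val_one]
  -- pointwise bound
  have hpt : ∀ t ∈ S,
      ‖dividedDifference (classGroupLFunction K ψ) (1 / 2 + t * I) (1 / 2 + t' t * I) -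
          xQuot q (1 / 2 + t * I) (1 / 2 + t' t * I) *
            starRingEnd ℂ (shortLSum K ψ q (1 / 2 + t * I))‖ ^ 2 ≤
        12 * ‖(afeA K ψ q (1 / 2 + t * I) - afeA K ψ q (1 / 2 + t' t * I)) /
              ((t : ℂ) * I - t' t * I)‖ ^ 2 +
          3 * ((3 * C₃ * LT) ^ 2 *
              ‖afeA K ψ q (1 / 2 + t * I) - shortLSum K ψ q (1 / 2 + t * I)‖ ^ 2) +
          3 * ‖(afeR K ψ q (1 / 2 + t * I) - afeR K ψ q (1 / 2 + t' t * I)) /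
              ((t : ℂ) * I - t' t * I)‖ ^ 2 := by
    intro t ht
    have hTt : T < t := (hS.mem_bounds ht).1
    have ht2T : t ≤ 2 * T := (hS.mem_bounds ht).2
    have ht0 : 0 < t := by linarith
    have ht2 : (2 : ℝ) ≤ t := by linarith
    have htne : t ≠ 0 := by linarith
    have ht'ne : t' t ≠ 0 := by
      have := (hclose t ht).2
      intro h0; rw [h0, zero_sub, abs_neg, abs_of_pos ht0] at this; linarith
    have hid := pointwise_identity (L := classGroupLFunction K ψ) (A := afeA K ψ q)
      (X := afeX q) (R := afeR K ψ q) (hclose t ht).1 (shortLSum K ψ q (1 / 2 + t * I))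
      (by have := classGroupLFunction_eq_afe_all q hq hodd K h2 hdisc ψ t htne; rwa [hW, one_mul] at this)
      (by have := classGroupLFunction_eq_afe_all q hq hodd K h2 hdisc ψ (t' t) ht'ne
          rwa [hW, one_mul] at this)
    have hX1 : ‖afeX q (1 / 2 + t' t * I)‖ = 1 := norm_afeX_half q hq0 (t' t)
    have hineq :
        ‖dividedDifference (classGroupLFunction K ψ) (1 / 2 + t * I) (1 / 2 + t' t * I) -
            xQuot q (1 / 2 + t * I) (1 / 2 + t' t * I) *
              starRingEnd ℂ (shortLSum K ψ q (1 / 2 + t * I))‖ ^ 2 ≤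
          12 * ‖(afeA K ψ q (1 / 2 + t * I) - afeA K ψ q (1 / 2 + t' t * I)) /
                ((t : ℂ) * I - t' t * I)‖ ^ 2 +
            3 * (‖xQuot q (1 / 2 + t * I) (1 / 2 + t' t * I)‖ ^ 2 *
                ‖starRingEnd ℂ (afeA K ψ q (1 / 2 + t * I) - shortLSum K ψ q (1 / 2 + t * I))‖ ^ 2) +
            3 * ‖(afeR K ψ q (1 / 2 + t * I) - afeR K ψ q (1 / 2 + t' t * I)) /
                ((t : ℂ) * I - t' t * I)‖ ^ 2 :=
      norm_sq_le_three (X' := afeX q (1 / 2 + t' t * I)) hX1 (Complex.norm_conj _)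
        (by simpa only [xQuot] using hid)
    rw [Complex.norm_conj] at hineq
    refine hineq.trans ?_
    have hxb : ‖xQuot q (1 / 2 + t * I) (1 / 2 + t' t * I)‖ ≤ 3 * C₃ * LT := by
      refine (hx q hq t (t' t) ht2).trans ?_
      have hlogt : Real.log t ≤ Real.log (2 * T) := Real.log_le_log ht0 ht2T
      have hlog2T : Real.log (2 * T) ≤ 2 * LT := by
        rw [Real.log_mul (by norm_num) hT0.ne']
        have : Real.log 2 ≤ LT := le_trans (by
          have := Real.log_two_lt_d9; linarith) hLT1.le
        linarith
      nlinarith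
    have hx2 : ‖xQuot q (1 / 2 + t * I) (1 / 2 + t' t * I)‖ ^ 2 ≤ (3 * C₃ * LT) ^ 2 :=
      pow_le_pow_left₀ (norm_nonneg _) hxb 2
    gcongr
  -- sum over `S`
  have hsum : defectD K ψ q S t' ≤
      12 * ∑ t ∈ S, ‖(afeA K ψ q (1 / 2 + t * I) - afeA K ψ q (1 / 2 + t' t * I)) /
              ((t : ℂ) * I - t' t * I)‖ ^ 2 +
        3 * (3 * C₃ * LT) ^ 2 *
          ∑ t ∈ S, ‖afeA K ψ q (1 / 2 + t * I) - shortLSum K ψ q (1 / 2 + t * I)‖ ^ 2 +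
        3 * ∑ t ∈ S, ‖(afeR K ψ q (1 / 2 + t * I) - afeR K ψ q (1 / 2 + t' t * I)) /
              ((t : ℂ) * I - t' t * I)‖ ^ 2 := by
    unfold defectD
    refine (Finset.sum_le_sum hpt).trans (le_of_eq ?_)
    rw [Finset.sum_add_distrib, Finset.sum_add_distrib, ← Finset.mul_sum, ← Finset.mul_sum,
      ← Finset.mul_sum, ← Finset.mul_sum]
    ring
  -- numerics
  set M : ℝ := T * ℓ ^ (7 : ℕ) + T * calL χ T * LT ^ (4 : ℕ) with hMdef
  have hcalL : 0 ≤ calL χ T := calL_nonneg χ (by linarith)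
  have hM0 : 0 ≤ M := by positivity
  have hTM : T ≤ M := by
    have h7 : (1 : ℝ) ≤ ℓ ^ (7 : ℕ) := one_le_pow₀ hℓ1.le
    have : T * 1 ≤ T * ℓ ^ (7 : ℕ) := by gcongr
    have : 0 ≤ T * calL χ T * LT ^ (4 : ℕ) := by positivity
    linarith
  have hAN' : (3 * C₃ * LT) ^ 2 *
      ∑ t ∈ S, ‖afeA K ψ q (1 / 2 + t * I) - shortLSum K ψ q (1 / 2 + t * I)‖ ^ 2 ≤
      9 * C₃ ^ 2 * (C₆ * M) := by
    have : (3 * C₃ * LT) ^ 2 = 9 * C₃ ^ 2 * LT ^ (2 : ℕ) := by ring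
    rw [this, mul_assoc]
    exact mul_le_mul_of_nonneg_left hAN (by positivity)
  have hCT : C₆ * T ≤ C₆ * M := mul_le_mul_of_nonneg_left hTM hC₆.le
  have e2 : 3 * (3 * C₃ * LT) ^ 2 *
      ∑ t ∈ S, ‖afeA K ψ q (1 / 2 + t * I) - shortLSum K ψ q (1 / 2 + t * I)‖ ^ 2 ≤
      27 * C₃ ^ 2 * (C₆ * M) := by
    rw [mul_assoc]; linarith [hAN']
  calc defectD K ψ q S t' ≤ _ := hsum
    _ ≤ 12 * (C₆ * M) + 27 * C₃ ^ 2 * (C₆ * M) + 3 * (C₆ * M) := by linarith [hB, e2, hr, hCT]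
    _ = (15 * C₆ + 27 * C₃ ^ 2 * C₆) * M := by ring

/-- **Coincident companions by a limit.** Each summand of `D` is continuous in the companion at the
diagonal (`(L(s) − L(s′))/(s − s′) → L′(s)`, `(X(s) − X(s′))/(s − s′) → X′(s)`: `L(·,ψ)` and `X`
are holomorphic at `s = ½ + it`), so a bound for all companion maps with `0 < |t′ − t| ≤ 1` gives
the same bound when some `t′(t) = t`. [cite: ConreyIwaniec2002, §8 (8.4) ("we may have `s_r = s′_r`")] -/
theorem defectD_limit {K : Type} [Field K] [NumberField K] (ψ : ClassGroup (𝓞 K) →* ℂˣ)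
    {q : ℕ} (hq : 0 < q) (S : Finset ℝ) (hS : ∀ t ∈ S, 0 < t) (t' : ℝ → ℝ) {B : ℝ}
    (h : ∀ ε : ℝ, 0 < ε → ε ≤ 1 →
      defectD K ψ q S (fun t => if t' t = t then t + ε else t' t) ≤ B) :
    defectD K ψ q S t' ≤ B := by
  classical
  -- the perturbed companion map and the summand as a function of `ε`
  set L := classGroupLFunction K ψ with hL
  set F : ℝ → ℝ → ℝ := fun t ε =>
    ‖dividedDifference L (1 / 2 + t * I) (1 / 2 + ↑(if t' t = t then t + ε else t' t) * I) -
        xQuot q (1 / 2 + t * I) (1 / 2 + ↑(if t' t = t then t + ε else t' t) * I) *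
          starRingEnd ℂ (shortLSum K ψ q (1 / 2 + t * I))‖ ^ 2 with hF
  have hDε : ∀ ε, defectD K ψ q S (fun t => if t' t = t then t + ε else t' t) = ∑ t ∈ S, F t ε := by
    intro ε; rfl
  have hD0 : defectD K ψ q S t' = ∑ t ∈ S, F t 0 := by
    unfold defectD; refine Finset.sum_congr rfl fun t _ => ?_
    simp only [hF, add_zero]
    split_ifs with h0
    · rw [h0]
    · rfl
  -- continuity of each summand at `ε → 0⁺`
  have hcont : ∀ t ∈ S, Tendsto (F t) (𝓝[>] 0) (𝓝 (F t 0)) := by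
    intro t ht
    by_cases h0 : t' t = t
    · -- the coincident case: slopes tend to derivatives
      have hs1 : (1 / 2 + t * I : ℂ) ≠ 1 := by
        intro h; have := congrArg Complex.im h; simp at this; linarith [hS t ht]
      have hLd : HasDerivAt L (deriv L (1 / 2 + t * I)) (1 / 2 + t * I) :=
        ((analyticAt_classGroupLFunction ψ hs1).differentiableAt).hasDerivAt
      have hXd : HasDerivAt (afeX q) (deriv (afeX q) (1 / 2 + t * I)) (1 / 2 + t * I) :=
        (hasDerivAt_afeX hq (by simp) (by simp; norm_num)).differentiableAt.hasDerivAt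
      -- the path `ε ↦ s + εI` tends to `s` within `≠`
      have hpath : Tendsto (fun ε : ℝ => (1 / 2 + ↑(t + ε) * I : ℂ)) (𝓝[>] 0)
          (𝓝[≠] (1 / 2 + t * I)) := by
        refine tendsto_nhdsWithin_of_tendsto_nhds_of_eventually_within _ ?_ ?_
        · have hc : Continuous (fun ε : ℝ => (1 / 2 + ↑(t + ε) * I : ℂ)) := by fun_prop
          have h : Tendsto (fun ε : ℝ => (1 / 2 + ↑(t + ε) * I : ℂ)) (𝓝[>] 0)
              (𝓝 (1 / 2 + ↑(t + 0) * I)) :=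
            (hc.tendsto 0).mono_left nhdsWithin_le_nhds
          simpa using h
        · filter_upwards [self_mem_nhdsWithin] with ε (hε : 0 < ε)
          intro h
          have := congrArg Complex.im h
          simp at this
          linarith
      have hslopeL := (hLd.tendsto_slope).comp hpath
      have hslopeX := (hXd.tendsto_slope).comp hpath
      -- rewrite slopes as divided differences
      have hdd : ∀ (f : ℂ → ℂ) (ε : ℝ), 0 < ε →
          dividedDifference f (1 / 2 + t * I) (1 / 2 + ↑(t + ε) * I) =
            slope f (1 / 2 + t * I) (1 / 2 + ↑(t + ε) * I) := by
        intro f ε hε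
        have hne : (1 / 2 + ↑(t + ε) * I : ℂ) ≠ 1 / 2 + t * I := by
          intro h; have := congrArg Complex.im h; simp at this; linarith
        rw [dividedDifference_of_ne f hne, slope_def_field,
          ← neg_sub (f (1 / 2 + ↑(t + ε) * I)) (f (1 / 2 + t * I)),
          ← neg_sub (1 / 2 + ↑(t + ε) * I : ℂ) (1 / 2 + t * I), neg_div_neg_eq]
      have hFε : ∀ ε : ℝ, 0 < ε → F t ε =
          ‖slope L (1 / 2 + t * I) (1 / 2 + ↑(t + ε) * I) -
            slope (afeX q) (1 / 2 + t * I) (1 / 2 + ↑(t + ε) * I) *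
              starRingEnd ℂ (shortLSum K ψ q (1 / 2 + t * I))‖ ^ 2 := by
        intro ε hε
        simp only [hF, h0, if_true, xQuot]
        rw [hdd L ε hε, hdd (afeX q) ε hε]
      have hF0 : F t 0 = ‖deriv L (1 / 2 + t * I) - deriv (afeX q) (1 / 2 + t * I) *
          starRingEnd ℂ (shortLSum K ψ q (1 / 2 + t * I))‖ ^ 2 := by
        simp only [hF, h0, if_true, add_zero, dividedDifference_self, xQuot_self]
      rw [hF0]
      have hlim : Tendsto (fun ε : ℝ => ‖slope L (1 / 2 + t * I) (1 / 2 + ↑(t + ε) * I) -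
            slope (afeX q) (1 / 2 + t * I) (1 / 2 + ↑(t + ε) * I) *
              starRingEnd ℂ (shortLSum K ψ q (1 / 2 + t * I))‖ ^ 2) (𝓝[>] 0)
          (𝓝 (‖deriv L (1 / 2 + t * I) - deriv (afeX q) (1 / 2 + t * I) *
            starRingEnd ℂ (shortLSum K ψ q (1 / 2 + t * I))‖ ^ 2)) :=
        ((hslopeL.sub (hslopeX.mul_const _)).norm).pow 2
      refine hlim.congr' ?_
      filter_upwards [self_mem_nhdsWithin] with ε (hε : 0 < ε)
      exact (hFε ε hε).symm
    · -- the companion is off the diagonal: the summand does not depend on `ε`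
      have : F t = fun _ => F t 0 := by
        funext ε; simp only [hF, h0, if_false]
      rw [this]; exact tendsto_const_nhds
  have hlim : Tendsto (fun ε => ∑ t ∈ S, F t ε) (𝓝[>] 0) (𝓝 (∑ t ∈ S, F t 0)) :=
    tendsto_finsetSum S hcont
  rw [hD0]
  refine le_of_tendsto hlim ?_
  have hmem : Set.Ioc (0 : ℝ) 1 ∈ 𝓝[>] (0 : ℝ) := Ioc_mem_nhdsGT (by norm_num)
  filter_upwards [hmem] with ε hε
  rw [← hDε]
  exact h ε hε.1 hε.2

/-- **Proposition 8.1 in the `_large_close` form from the three mean squares of §8** (`hS6`: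
(i) `Σ|B|²`, (ii) `(log T)²Σ|A − N|²`, (iii) `Σ|r|²`), Proposition 7.1 (`classGroupLFunction_eq_afe_all`),
`W(ψ) = 1` (`Quadratic.differentClass_eq_one_of_finrank_eq_two`), `|X| = 1`, `|x| ≪ log qT`, and the
coincident-companion limit. [cite: ConreyIwaniec2002, Proposition 8.1 (8.10)] -/
theorem prop81_large_close_of_meanSquares (hS6 : ∃ C : ℝ, 0 < C ∧
    ∀ (q : ℕ) [NeZero q], 4 < q → Odd q → ∀ χ : DirichletCharacter ℂ q,
      χ.IsPrimitive → χ.IsQuadratic → χ.Odd →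
        ∀ (K : Type) [Field K] [NumberField K],
          Module.finrank ℚ K = 2 → NumberField.discr K = -(q : ℤ) →
            ∀ (ψ : ClassGroup (𝓞 K) →* ℂˣ) (T : ℝ) (S : Finset ℝ) (t' : ℝ → ℝ),
              (q : ℝ) ^ (66 : ℕ) ≤ T → Real.exp (Real.log q ^ (2 : ℕ)) ≤ T → IsDyadicPointSet S T →
                (∀ t ∈ S, t' t ≠ t ∧ |t' t - t| ≤ 1) →
                (∑ t ∈ S, ‖(afeA K ψ q (1 / 2 + t * I) - afeA K ψ q (1 / 2 + t' t * I)) /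
                    ((t : ℂ) * I - t' t * I)‖ ^ 2 ≤
                  C * (T * Real.log q ^ (7 : ℕ) + T * calL χ T * Real.log T ^ (4 : ℕ))) ∧
                (Real.log T ^ (2 : ℕ) *
                    ∑ t ∈ S, ‖afeA K ψ q (1 / 2 + t * I) - shortLSum K ψ q (1 / 2 + t * I)‖ ^ 2 ≤
                  C * (T * Real.log q ^ (7 : ℕ) + T * calL χ T * Real.log T ^ (4 : ℕ))) ∧
                (∑ t ∈ S, ‖(afeR K ψ q (1 / 2 + t * I) - afeR K ψ q (1 / 2 + t' t * I)) /
                    ((t : ℂ) * I - t' t * I)‖ ^ 2 ≤ C * T)) :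
    conreyIwaniec2002_proposition81_large_close := by
  obtain ⟨C, hC, h⟩ := defectD_le_of_meanSquares hS6
  refine ⟨C, hC, fun q _ hq hodd χ hprim hquad hoddχ K _ _ h2 hdisc ψ T S t' hT hexpT hS hclose => ?_⟩
  have hq0 : 0 < q := by omega
  have hq5 : (5 : ℝ) ≤ q := by exact_mod_cast hq
  have hq_le_T : (q : ℝ) ≤ T := le_trans (le_self_pow₀ (by linarith) (by norm_num)) hT
  have hSpos : ∀ t ∈ S, 0 < t := fun t ht => by linarith [(hS.mem_bounds ht).1]
  refine defectD_limit ψ hq0 S hSpos t' fun ε hε hε1 => ?_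
  refine h q hq hodd χ hprim hquad hoddχ K h2 hdisc ψ T S _ hT hexpT hS fun t ht => ?_
  by_cases h0 : t' t = t
  · simp only [h0, if_true]
    constructor
    · linarith
    · rw [show t + ε - t = ε by ring, abs_of_pos hε]; exact hε1
  · simp only [h0, if_false]
    exact ⟨h0, hclose t ht⟩

end ConreyIwaniec2002

end Literature.NumberTheory.LFunctions

end
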